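import Summits.RiemannHypothesis.RiemannHypothesis.Theorems.PfPersistenceResolventSign
import HarnessLib

/-!
# PF persistence — RESOLVENT PROFILE: the SHARP pointwise certificate for a one-signed resolvent profile
(pub-rhpf, barrier-prover gen 3; typed at the request of `pub-rhpf-ctrl-2` g7, VERIFY §Z: "type 'resolvent positivity' on
the PROFILE, not on Galerkin coordinates"; DATA there: SHARP holds on 18/18 exact planted-polepair instances, margin ≥ 4.3×,
while coordinatewise positivity of the resolvent vector is false in the even sector)

**HONEST FRAMING. This is a long-odds MECHANISM SEARCH; no RH claims.** RH-free finite-dimensional linear algebra; no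
`ζ` statement occurs. Every statement PROVED; the numerical inequalities are HYPOTHESES on named quantities, scored
elsewhere (DATA), never asserted.

THE IDENTITY. If `(T − λ₁)r = u` with `λ₁ < 0` then `|λ₁|·r = u − T r`, hence on the window PROFILES
`|λ₁|·θ_r(x) = θ_u(x) − θ_{Tr}(x)`. SHARP CERTIFICATE (`resolvent_profile_pos_of_sharp`): if `|θ_{Tr}(x)| < θ_u(x)` at
every `x` of the window then `θ_r > 0` on the window; with a margin `μ`, `θ_r ≥ μ/|λ₁|`
(`resolvent_profile_ge_of_sharp`). Composed with `PfPersistenceResolventSign` (`oneSigned_of_resolvent_oneSigned`):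
under the separation `λ₁ := ε₁(T − c·uuᵀ) < ε₁(T)`, `λ₁ < 0`, the resolvent equation and SHARP, EVERY bottom vector
of `T − c·uuᵀ` has a one-signed window profile (`bottom_oneSigned_of_sharp`) — the `T1`/`oneSignedAt` verdict of a
planted-type control, decided by three scoreable numbers per window.
-/

set_option linter.dupNamespace false  -- the mandated namespace repeats `RiemannHypothesis`

noncomputable section

open Real Finset Matrix Set

namespace Summit.RiemannHypothesis.RiemannHypothesis.Theorems.PfPersistence

/-- PROVED: profiles are subtractive in the coefficient vector. [folklore] -/
theorem profile_sub_vec (L : ℝ) {N : ℕ} (v w : Fin (N + 1) → ℝ) (x : ℝ) :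
    profile L (v - w) x = profile L v x - profile L w x := by
  simp only [profile, Pi.sub_apply, sub_mul, Finset.sum_sub_distrib]

/-- **PROVED — THE RESOLVENT IDENTITY ON PROFILES.** `(T − λ₁)r = u` ⇒ `(−λ₁)·θ_r(x) = θ_u(x) − θ_{Tr}(x)`. [folklore] -/
theorem resolvent_profile_identity {N : ℕ} {T : Matrix (Fin (N + 1)) (Fin (N + 1)) ℝ} {u r : Fin (N + 1) → ℝ}
    {lam : ℝ} (hr : (T - lam • (1 : Matrix (Fin (N + 1)) (Fin (N + 1)) ℝ)) *ᵥ r = u) (L x : ℝ) :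
    (-lam) * profile L r x = profile L u x - profile L (T *ᵥ r) x := by
  have hvec : (-lam) • r = u - T *ᵥ r := by
    rw [← hr, sub_mulVec, Matrix.smul_mulVec, one_mulVec, neg_smul]
    abel
  rw [← profile_smul_vec, hvec, profile_sub_vec]

/-- **PROVED — SHARP CERTIFICATE.** `λ₁ < 0`, `(T − λ₁)r = u` and `|θ_{Tr}(x)| < θ_u(x)` on the window ⇒ `θ_r > 0` on the
window. [folklore] -/
theorem resolvent_profile_pos_of_sharp {N : ℕ} {T : Matrix (Fin (N + 1)) (Fin (N + 1)) ℝ} {u r : Fin (N + 1) → ℝ}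
    {lam : ℝ} (hlam : lam < 0) (hr : (T - lam • (1 : Matrix (Fin (N + 1)) (Fin (N + 1)) ℝ)) *ᵥ r = u) {L : ℝ}
    (hsharp : ∀ x ∈ Set.Icc (-(L / 2)) (L / 2), |profile L (T *ᵥ r) x| < profile L u x) :
    ∀ x ∈ Set.Icc (-(L / 2)) (L / 2), 0 < profile L r x := by
  intro x hx
  have hid := resolvent_profile_identity hr L x
  have h1 : 0 < profile L u x - profile L (T *ᵥ r) x := by
    have := (abs_lt.1 (hsharp x hx)).2
    linarith
  rw [← hid] at h1
  rcases pos_and_pos_or_neg_and_neg_of_mul_pos h1 with ⟨_, hb⟩ | ⟨ha, _⟩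
  · exact hb
  · linarith

/-- **PROVED — SHARP CERTIFICATE WITH MARGIN.** `λ₁ < 0`, `(T − λ₁)r = u`, `|θ_{Tr}(x)| ≤ θ_u(x) − μ` on the window ⇒
`θ_r(x) ≥ μ/(−λ₁)` on the window. [folklore] -/
theorem resolvent_profile_ge_of_sharp {N : ℕ} {T : Matrix (Fin (N + 1)) (Fin (N + 1)) ℝ} {u r : Fin (N + 1) → ℝ}
    {lam : ℝ} (hlam : lam < 0) (hr : (T - lam • (1 : Matrix (Fin (N + 1)) (Fin (N + 1)) ℝ)) *ᵥ r = u) {L μ : ℝ}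
    (hsharp : ∀ x ∈ Set.Icc (-(L / 2)) (L / 2), |profile L (T *ᵥ r) x| ≤ profile L u x - μ) :
    ∀ x ∈ Set.Icc (-(L / 2)) (L / 2), μ / (-lam) ≤ profile L r x := by
  intro x hx
  have hid := resolvent_profile_identity hr L x
  have h1 : μ ≤ profile L u x - profile L (T *ᵥ r) x := by
    have := (abs_le.1 (hsharp x hx)).2
    linarith
  rw [← hid] at h1
  rw [div_le_iff₀ (by linarith : (0:ℝ) < -lam)]
  linarith

/-- **PROVED — EVERY BOTTOM VECTOR OF `T − c·uuᵀ` HAS A ONE-SIGNED WINDOW PROFILE, from three scoreable facts:**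
separation `λ₁ := ε₁(T − c·uuᵀ) < ε₁(T)`, negativity `λ₁ < 0` with the resolvent equation `(T − λ₁)r = u`, and the
SHARP pointwise certificate `|θ_{Tr}| < θ_u` on the window. [folklore] -/
theorem bottom_oneSigned_of_sharp {N : ℕ} {T : Matrix (Fin (N + 1)) (Fin (N + 1)) ℝ} {u : Fin (N + 1) → ℝ} {c : ℝ}
    (hsep : bottomRayleigh (T - c • vecMulVec u u) < bottomRayleigh T)
    (hneg : bottomRayleigh (T - c • vecMulVec u u) < 0) {r : Fin (N + 1) → ℝ}
    (hr : (T - bottomRayleigh (T - c • vecMulVec u u) • (1 : Matrix (Fin (N + 1)) (Fin (N + 1)) ℝ)) *ᵥ r = u)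
    {L : ℝ} (hsharp : ∀ x ∈ Set.Icc (-(L / 2)) (L / 2), |profile L (T *ᵥ r) x| < profile L u x)
    {x : Fin (N + 1) → ℝ} (hx : IsBottomVector (T - c • vecMulVec u u) x) : OneSigned L x :=
  oneSigned_of_resolvent_oneSigned hsep hr
    (Or.inl fun y hy => (resolvent_profile_pos_of_sharp hneg hr hsharp y hy).le) hx

/-- **PROVED — the margin version: a margin `μ > 0` in SHARP gives every bottom vector a one-signed profile AND the
resolvent profile the explicit floor `μ/|λ₁|`** (the latter is what a `OneSignedMargin` binder of the
eigenvector-tolerance wall asks of the reference vector, up to the bottom vector's own normalisation). [folklore] -/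
theorem bottom_oneSigned_of_sharp_margin {N : ℕ} {T : Matrix (Fin (N + 1)) (Fin (N + 1)) ℝ} {u : Fin (N + 1) → ℝ}
    {c : ℝ} (hsep : bottomRayleigh (T - c • vecMulVec u u) < bottomRayleigh T)
    (hneg : bottomRayleigh (T - c • vecMulVec u u) < 0) {r : Fin (N + 1) → ℝ}
    (hr : (T - bottomRayleigh (T - c • vecMulVec u u) • (1 : Matrix (Fin (N + 1)) (Fin (N + 1)) ℝ)) *ᵥ r = u)
    {L μ : ℝ} (hμ : 0 < μ) (hsharp : ∀ x ∈ Set.Icc (-(L / 2)) (L / 2), |profile L (T *ᵥ r) x| ≤ profile L u x - μ)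
    {x : Fin (N + 1) → ℝ} (hx : IsBottomVector (T - c • vecMulVec u u) x) :
    OneSigned L x ∧ OneSignedMargin L (μ / (-bottomRayleigh (T - c • vecMulVec u u))) r :=
  ⟨oneSigned_of_resolvent_oneSignedMargin hsep hr (div_pos hμ (by linarith)).le
      (Or.inl (resolvent_profile_ge_of_sharp hneg hr hsharp)) hx,
    Or.inl (resolvent_profile_ge_of_sharp hneg hr hsharp)⟩

end Summit.RiemannHypothesis.RiemannHypothesis.Theorems.PfPersistence

end
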